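import Literature.AlgebraicGeometry.Resolution.BlowupAlgebraPresentation
import HarnessLib

/-!
# The obvious relations cut out the affine blowup algebra set-theoretically

Topic: `Literature/AlgebraicGeometry/Resolution`. A complement (theorems only, no named facts) to
`BlowupAlgebraPresentation.lean` (the image model `R[I/xᵢ] ⊆ R[1/xᵢ]` of the affine blowup algebra of
`I = (x₁, …, x_r)`, its evaluation presentation `eval : R[T_j : j ≠ i] → R[I/xᵢ]`, `T_j ↦ x_j/xᵢ`, and the
relations modulo `xᵢ`, Stacks 0BIQ):

* `blowupAlgebra.rel x i j = x_j - xᵢ T_j` — the obvious relations, lying in `ker eval` (`eval_rel`);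
* `blowupAlgebra.zeroLocus_ker_eval` — **for a quasi-regular sequence `x`, `V(ker eval) = V(x_j - xᵢ T_j : j ≠ i)`
  in `Spec R[T]`**: a prime containing the obvious relations contains the whole kernel. Over `xᵢ ≠ 0` one
  tests with the ring map `R[1/xᵢ] → Frac(R[T]/Q)` (`blowupAlgebra.ker_eval_le_ker`), over `xᵢ = 0` the
  kernel lies in `I · R[T]` (`blowupAlgebra.comap_eval_span_algebraMap_eq`, Stacks 0BIQ).

This is the set-theoretic input for identifying REDUCED closed subschemes given by the obvious
equations `xᵢ y_j = x_j yᵢ` (closures of graphs, incidence varieties of linear projections) with charts of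
blow-ups (`Motives/LinearSectionNet`).

## References

* The Stacks Project, Tags 052P, 0BIQ (affine blowup algebras). [StacksProject]
* U. Görtz, T. Wedhorn, *Algebraic Geometry I*, 2nd ed. (2020), (13.19) p. 415. [GortzWedhorn2020]
-/

noncomputable section

open IsLocalization

universe u

namespace Literature.AlgebraicGeometry.Resolution


namespace blowupAlgebra

variable {R : Type u} [CommRing R] {r : ℕ} (x : Fin r → R) (i : Fin r)

/-- The obvious relations `x_j - xᵢ T_j` (`j ≠ i`) of the affine blowup algebra `R[I/xᵢ]`,
`T_j ↦ x_j/xᵢ`. [cite: StacksProject, Tag 052P] -/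
def rel (j : {j : Fin r // j ≠ i}) : MvPolynomial {j : Fin r // j ≠ i} R :=
  MvPolynomial.C (x j.1) - MvPolynomial.C (x i) * MvPolynomial.X j

/-- The relations hold in `R[I/xᵢ]`: `x_j - xᵢ · (x_j/xᵢ) = 0`. [folklore] -/
theorem eval_rel (j : {j : Fin r // j ≠ i}) : eval x i (rel x i j) = 0 := by
  rw [rel, map_sub, map_mul, eval_C, eval_C, eval_X, frac, blowupAlgebra.algebraMap_mul_gen, sub_self]

/-- The relations lie in the kernel of the evaluation map. [folklore] -/
theorem range_rel_subset_ker : Set.range (rel x i) ⊆ RingHom.ker (eval x i).toRingHom := by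
  rintro _ ⟨j, rfl⟩
  exact eval_rel x i j

/-- **The relations cut out the affine blowup algebra set-theoretically**: for a quasi-regular
sequence `x`, a prime of `R[T_j : j ≠ i]` contains the kernel of `T_j ↦ x_j/xᵢ` as soon as it
contains the obvious relations `x_j - xᵢ T_j` (over `xᵢ ≠ 0` the kernel is generated by them after
inverting `xᵢ`; over `xᵢ = 0` the kernel lies in `I · R[T]`, Stacks 0BIQ). [cite: StacksProject, Tag 0BIQ] -/
theorem zeroLocus_ker_eval (hx : IsQuasiRegular x) :
    PrimeSpectrum.zeroLocus (RingHom.ker (eval x i).toRingHom : Set (MvPolynomial {j : Fin r // j ≠ i} R)) =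
      PrimeSpectrum.zeroLocus (Set.range (rel x i)) := by
  refine le_antisymm (PrimeSpectrum.zeroLocus_anti_mono (range_rel_subset_ker x i)) ?_
  intro Q hQ
  rw [PrimeSpectrum.mem_zeroLocus] at hQ ⊢
  intro f hf
  rw [SetLike.mem_coe] at hf ⊢
  by_cases hi : MvPolynomial.C (x i) ∈ Q.asIdeal
  · -- over `xᵢ = 0`: all `x_j ∈ Q`, and `ker ⊆ I · R[T] ⊆ Q`
    have hall : ∀ j : Fin r, MvPolynomial.C (x j) ∈ Q.asIdeal := by
      intro j
      by_cases hji : j = i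
      · rw [hji]; exact hi
      · have h := hQ ⟨⟨j, hji⟩, rfl⟩
        rw [SetLike.mem_coe, rel] at h
        have : (MvPolynomial.C (x j) : MvPolynomial {j : Fin r // j ≠ i} R) =
            (MvPolynomial.C (x j) - MvPolynomial.C (x i) * MvPolynomial.X (⟨j, hji⟩ : {j : Fin r // j ≠ i})) +
            MvPolynomial.C (x i) * MvPolynomial.X (⟨j, hji⟩ : {j : Fin r // j ≠ i}) := by ring
        rw [this]
        exact Q.asIdeal.add_mem h (Q.asIdeal.mul_mem_right _ hi)
    have hker : f ∈ (Ideal.span {algebraMap R (blowupAlgebra (Ideal.span (Set.range x)) (x i)) (x i)}).comap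
        (eval x i).toRingHom := by
      rw [Ideal.mem_comap, RingHom.mem_ker.mp hf]
      exact Ideal.zero_mem _
    rw [comap_eval_span_algebraMap_eq x i hx] at hker
    have hle : Ideal.map MvPolynomial.C (Ideal.span (Set.range x)) ≤ Q.asIdeal := by
      rw [Ideal.map_span, Ideal.span_le]
      rintro _ ⟨_, ⟨j, rfl⟩, rfl⟩
      exact hall j
    exact hle hker
  · -- over `xᵢ ≠ 0`: test with `R[1/xᵢ] → Frac (R[T]/Q)`
    set D := MvPolynomial {j : Fin r // j ≠ i} R ⧸ Q.asIdeal with hD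
    haveI : IsDomain D := Ideal.Quotient.isDomain Q.asIdeal
    set K := FractionRing D with hK
    set g : R →+* K := (algebraMap D K).comp ((Ideal.Quotient.mk Q.asIdeal).comp MvPolynomial.C) with hg
    have hgi : IsUnit (g (x i)) := by
      refine Ne.isUnit ?_
      rw [hg, RingHom.comp_apply, RingHom.comp_apply, Ne,
        ← map_zero (algebraMap D K), (IsFractionRing.injective D K).eq_iff, Ideal.Quotient.eq_zero_iff_mem]
      exact hi
    set θ : Localization.Away (x i) →+* K := IsLocalization.Away.lift (x i) hgi with hθ
    have hθalg : θ.comp (algebraMap R (Localization.Away (x i))) = g :=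
      IsLocalization.Away.lift_comp (x i) hgi
    have hθfrac : ∀ j : {j : Fin r // j ≠ i}, θ (frac x i j.1) =
        algebraMap D K (Ideal.Quotient.mk Q.asIdeal (MvPolynomial.X j)) := by
      intro j
      have h1 : θ (frac x i j.1) * g (x i) = g (x j.1) := by
        rw [← hθalg, RingHom.comp_apply, RingHom.comp_apply, ← map_mul, coe_frac, div_mul_algebraMap]
      have h2 : algebraMap D K (Ideal.Quotient.mk Q.asIdeal (MvPolynomial.X j)) * g (x i) = g (x j.1) := by
        rw [hg, RingHom.comp_apply, RingHom.comp_apply, RingHom.comp_apply, RingHom.comp_apply, ← map_mul,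
          ← map_mul, (IsFractionRing.injective D K).eq_iff, eq_comm, ← sub_eq_zero, ← map_sub,
          Ideal.Quotient.eq_zero_iff_mem, mul_comm]
        exact hQ ⟨j, rfl⟩
      exact hgi.mul_left_injective (h1.trans h2.symm)
    have hle := ker_eval_le_ker x i θ hf
    rw [RingHom.mem_ker] at hle
    have heq : MvPolynomial.eval₂Hom (θ.comp (algebraMap R (Localization.Away (x i))))
        (fun j : {j : Fin r // j ≠ i} => θ (frac x i j.1)) =
        (algebraMap D K).comp (Ideal.Quotient.mk Q.asIdeal) := by
      refine MvPolynomial.ringHom_ext (fun c => ?_) (fun j => ?_)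
      · rw [MvPolynomial.eval₂Hom_C, hθalg]
        rfl
      · rw [MvPolynomial.eval₂Hom_X', hθfrac]
        rfl
    rw [heq, RingHom.comp_apply, ← map_zero (algebraMap D K), (IsFractionRing.injective D K).eq_iff,
      Ideal.Quotient.eq_zero_iff_mem] at hle
    exact hle

end blowupAlgebra

end Literature.AlgebraicGeometry.Resolution

end
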